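import Mathlib.RingTheory.Kaehler.Basic
import Mathlib.RingTheory.Unramified.Basic
import HarnessLib

/-!
# Kähler differentials do not see a localization of the base: `Ω[B⁄R] ≅ Ω[B⁄M⁻¹R]`

Let `R → S = M⁻¹R` be a localization and `B` an `S`-algebra. Then the canonical surjection
`Ω[B⁄R] → Ω[B⁄S]` (Mathlib `KaehlerDifferential.map R S B B`, `KaehlerDifferential.map_surjective`)
is bijective: its kernel is generated by the image of `B ⊗[S] Ω[S⁄R]` (the exact sequence
`B ⊗[S] Ω[S⁄R] → Ω[B⁄R] → Ω[B⁄S] → 0`, Mathlib `KaehlerDifferential.exact_mapBaseChange_map`), and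
`Ω[S⁄R] = 0` because a localization is formally unramified (Mathlib
`Algebra.FormallyUnramified.of_isLocalization`).

* `kaehlerDifferential_map_bijective_of_isLocalization`;
* `kaehlerDifferentialEquivOfIsLocalization : Ω[B⁄R] ≃ₗ[B] Ω[B⁄S]`, sending `d_R b ↦ d_S b`
  (`kaehlerDifferentialEquivOfIsLocalization_D`).

## Why

For a `W(k)`-scheme `𝒳` with generic fibre `X_K`, `K = W[1/p]` (a localization,
`Motives/WittSchemeGenericFibre`), the relative de Rham complex of `𝒳/W` restricted to the open
subscheme `X_K` is the de Rham complex of `X_K/K`: on affine pieces this is `Ω[B⁄W] = Ω[B⁄K]` for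
the `K`-algebras `B = Γ(V, 𝒪)`, `V ⊆ X_K`.

## References

* H. Matsumura, *Commutative Ring Theory*, CUP 1986, Thm. 25.1 (the exact sequence
  `Ω_{S/R} ⊗ B → Ω_{B/R} → Ω_{B/S} → 0`) and Exercise 25.4 (`Ω` and localization). [folklore]
-/

noncomputable section

open scoped TensorProduct

namespace Literature.RingTheory.Localization

variable (R S B : Type*) [CommRing R] [CommRing S] [CommRing B] [Algebra R S] [Algebra R B]
  [Algebra S B] [IsScalarTower R S B] (M : Submonoid R) [IsLocalization M S]

include M in
/-- **`Ω[B⁄R] → Ω[B⁄M⁻¹R]` is bijective** for an algebra `B` over a localization `S = M⁻¹R` of `R`: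
surjective always (Mathlib `KaehlerDifferential.map_surjective`), injective because the kernel is
the image of `B ⊗ Ω[S⁄R]` (`KaehlerDifferential.exact_mapBaseChange_map`) and `Ω[S⁄R] = 0`
(`Algebra.FormallyUnramified.of_isLocalization`). [folklore] -/
theorem kaehlerDifferential_map_bijective_of_isLocalization :
    Function.Bijective (KaehlerDifferential.map R S B B) := by
  haveI : Algebra.FormallyUnramified R S := Algebra.FormallyUnramified.of_isLocalization M
  refine ⟨?_, KaehlerDifferential.map_surjective R S B⟩
  rw [← LinearMap.ker_eq_bot, Submodule.eq_bot_iff]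
  intro x hx
  obtain ⟨y, rfl⟩ := (KaehlerDifferential.exact_mapBaseChange_map R S B x).mp hx
  clear hx
  induction y using TensorProduct.induction_on with
  | zero => exact map_zero _
  | tmul b ω => rw [Subsingleton.elim ω 0, TensorProduct.tmul_zero, map_zero]
  | add y z hy hz => rw [map_add, hy, hz, add_zero]

/-- **`Ω[B⁄R] ≃ₗ[B] Ω[B⁄M⁻¹R]`**: Kähler differentials of an algebra over a localization
`S = M⁻¹R` are the same relative to `R` and to `S` (Matsumura, Exercise 25.4). [folklore] -/
def kaehlerDifferentialEquivOfIsLocalization : Ω[B⁄R] ≃ₗ[B] Ω[B⁄S] :=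
  LinearEquiv.ofBijective (KaehlerDifferential.map R S B B)
    (kaehlerDifferential_map_bijective_of_isLocalization R S B M)

/-- The equivalence `Ω[B⁄R] ≃ Ω[B⁄S]` is `KaehlerDifferential.map R S B B`. [folklore] -/
@[simp]
theorem kaehlerDifferentialEquivOfIsLocalization_apply (x : Ω[B⁄R]) :
    kaehlerDifferentialEquivOfIsLocalization R S B M x = KaehlerDifferential.map R S B B x :=
  rfl

/-- The equivalence `Ω[B⁄R] ≃ Ω[B⁄S]` sends `d_R b` to `d_S b`. [folklore] -/
@[simp]
theorem kaehlerDifferentialEquivOfIsLocalization_D (b : B) :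
    kaehlerDifferentialEquivOfIsLocalization R S B M (KaehlerDifferential.D R B b) =
      KaehlerDifferential.D S B b :=
  KaehlerDifferential.map_D R S B B b

end Literature.RingTheory.Localization
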